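import Mathlib
import HarnessLib

/-!
# ζ(5) search — Rhin–Viola's birational change of variables `ϑ` of the cube `(0,1)³` (cell `pub-zeta5`, seat ct-1 g12)

HONEST FRAMING: systematic search; no irrationality claim unless kernel-certified. Nothing in this file is an
irrationality result, a worthiness exponent or a denominator statement. It is a change of variables: the map
`ϑ : (x,y,z) ↦ (X,Y,Z) = ((1−y)z, (1−x)(1−z)/(1−(1−xy)z), y/(1−(1−y)z))` of Rhin–Viola
[G. Rhin, C. Viola, *The group structure for ζ(3)*, Acta Arith. 97 (2001), §2, display before (2.4)], the one
non-hypergeometric generator of their permutation group `Φ = ⟨ϑ, σ, φ, χ⟩` (order 1920) for the Beukers-type triple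
integrals `∫ x^h(1−x)^l y^k(1−y)^s z^j(1−z)^q (1−(1−xy)z)^{−(q+h−r+1)}` — the same integrand shape as the `(y₁,y₂,y₃)`-block of
Brown–Zudilin's `J(p;q)` [BrownZudilin2022, (10), (23)]. Brown–Zudilin obtain the generators `h, h'` of their group `G`
from Bailey's `₇F₆` transformation; by Zudilin's dictionary that transformation lives in `Φ`, whose generators are all
elementary (`φ`, `χ` = the `₂F₁` Euler-integral symmetry of `EulerKernelSymmetry.lean`, `σ` = swap, and `ϑ`). This file
provides `ϑ` as kernel theorems, exponent-free:

* `ϑ` maps `(0,1)³` onto itself, with inverse `(X,Y,Z) ↦ ((1−Y)(1−Z)/(1−(1−XY)Z), (1−X)Z, X/(1−(1−X)Z))` [RV (2.6)]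
  (`rvTheta_image`, `rvTheta_injOn`); the seven atoms transform as `1−X = N`, `Y = (1−x)(1−z)/L`, `1−Y = xN/L`, `Z = y/N`,
  `1−Z = (1−y)(1−z)/N`, `1−(1−XY)Z = (1−y)(1−z)/L` with `L = 1−(1−xy)z`, `N = 1−(1−y)z` (`rvTheta_atoms`) — RV (2.5);
* Jacobian `det Dϑ = −(1−y)(1−z)/L²` (`hasFDerivAt_rvTheta`), i.e. `|dXdYdZ/dxdydz| = (1−(1−XY)Z)/(1−(1−xy)z)` — RV (2.5);
* **`integral_comp_rvTheta`**: `∫_{(0,1)³} g = ∫_{(0,1)³} (1−y)(1−z)/L² · g ∘ ϑ` for EVERY `g` (Bochner; no integrability needed);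
* **`rv_theta_invariance`**: for ALL integer exponents with `j + q = l + s` [RV (2.3)],
  `∫ x^h(1−x)^l y^k(1−y)^s z^j(1−z)^q L^{−c} = ∫ x^s(1−x)^k y^j(1−y)^{h+q+1−c} z^h(1−z)^{k+q+1−c} L^{−(k+s+2−c)}` — RV's
  "`I(h,j,k,l,m,q,r,s) = I(j,k,l,m,q,r,s,h)`" for the generator `ϑ` of their dihedral group `Θ = ⟨ϑ, σ⟩`.

Theorems only (no new definitions; `ϑ` is written as a lambda).
-/

noncomputable section

namespace Summit.KontsevichZagierPeriods.Zeta5Search.RhinViolaTheta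

open MeasureTheory Set Filter
open ContinuousLinearMap (proj)

/-! ### The cube, the map and its inverse -/

/-- Membership in `(0,1)³` unpacked. -/
theorem mem_cube3 {x : Fin 3 → ℝ} (hx : x ∈ (univ.pi fun _ : Fin 3 => Ioo (0:ℝ) 1)) (i : Fin 3) :
    0 < x i ∧ x i < 1 := by
  simpa using hx i (mem_univ i)

/-- A vector literal lies in `(0,1)³` iff its three entries do. -/
theorem vec3_mem_cube3 {a b c : ℝ} (ha : 0 < a ∧ a < 1) (hb : 0 < b ∧ b < 1) (hc : 0 < c ∧ c < 1) :
    (![a, b, c] : Fin 3 → ℝ) ∈ (univ.pi fun _ : Fin 3 => Ioo (0:ℝ) 1) := by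
  intro i _
  fin_cases i
  · exact ha
  · exact hb
  · exact hc

/-- Basic inequalities on the cube: `L = 1−(1−xy)z > 0`, `N = 1−(1−y)z > 0`, and the bounds making `ϑ(x) ∈ (0,1)³`. -/
theorem cube3_aux {x y z : ℝ} (hx : 0 < x ∧ x < 1) (hy : 0 < y ∧ y < 1) (hz : 0 < z ∧ z < 1) :
    0 < 1 - (1 - x * y) * z ∧ 0 < 1 - (1 - y) * z ∧ (1 - x) * (1 - z) < 1 - (1 - x * y) * z ∧ y < 1 - (1 - y) * z ∧
      0 < (1 - y) * z ∧ (1 - y) * z < 1 := by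
  have hxy : 0 < x * y := mul_pos hx.1 hy.1
  have hxy1 : x * y < 1 := by nlinarith [mul_lt_of_lt_one_right hx.1 hy.2]
  have h1 : 0 < 1 - (1 - x * y) * z := by nlinarith [mul_lt_of_lt_one_right (sub_pos.mpr hxy1) hz.2]
  have h2 : 0 < 1 - (1 - y) * z := by nlinarith [mul_lt_of_lt_one_right (sub_pos.mpr hy.2) hz.2]
  refine ⟨h1, h2, ?_, ?_, mul_pos (sub_pos.mpr hy.2) hz.1, ?_⟩
  · nlinarith [mul_pos hx.1 h2, mul_pos hy.1 hz.1]
  · nlinarith [mul_pos (sub_pos.mpr hy.2) (sub_pos.mpr hz.2)]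
  · nlinarith [mul_lt_of_lt_one_right (sub_pos.mpr hy.2) hz.2]

/-! ### The atoms after `ϑ` [RV (2.5)] -/

/-- The atoms after `ϑ`: with `L = 1−(1−xy)z`, `N = 1−(1−y)z` (both `≠ 0`),
`1−Y = xN/L`, `1−Z = (1−y)(1−z)/N`, `1−(1−XY)Z = (1−y)(1−z)/L` (and trivially `X = (1−y)z`, `1−X = N`,
`Y = (1−x)(1−z)/L`, `Z = y/N`). -/
theorem rvTheta_atoms {x y z : ℝ} (hL : 1 - (1 - x * y) * z ≠ 0) (hN : 1 - (1 - y) * z ≠ 0) :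
    1 - (1 - x) * (1 - z) / (1 - (1 - x * y) * z) = x * (1 - (1 - y) * z) / (1 - (1 - x * y) * z) ∧
    1 - y / (1 - (1 - y) * z) = (1 - y) * (1 - z) / (1 - (1 - y) * z) ∧
    1 - (1 - (1 - y) * z * ((1 - x) * (1 - z) / (1 - (1 - x * y) * z))) * (y / (1 - (1 - y) * z)) =
      (1 - y) * (1 - z) / (1 - (1 - x * y) * z) := by
  set L := 1 - (1 - x * y) * z with hLdef
  set N := 1 - (1 - y) * z with hNdef
  refine ⟨?_, ?_, ?_⟩
  · rw [eq_div_iff hL, sub_mul, div_mul_cancel₀ _ hL, hNdef, hLdef]; ring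
  · rw [eq_div_iff hN, sub_mul, div_mul_cancel₀ _ hN, hNdef]; ring
  · rw [eq_div_iff hL]; field_simp; rw [hLdef, hNdef]; ring

/-- The atoms after `ϑ⁻¹`: with `L' = 1−(1−X₀X₁)X₂`, `N' = 1−(1−X₀)X₂` (both `≠ 0`) and
`x' = ((1−X₁)(1−X₂)/L', (1−X₀)X₂, X₀/N')`: `L(x') = (1−X₀)(1−X₂)/L'`, `N(x') = 1−X₀`, `1−x'₀ = X₁N'/L'`, `1−x'₂ = (1−X₀)(1−X₂)/N'`. -/
theorem rvThetaInv_atoms {X0 X1 X2 : ℝ} (hL : 1 - (1 - X0 * X1) * X2 ≠ 0) (hN : 1 - (1 - X0) * X2 ≠ 0) :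
    1 - (1 - (1 - X1) * (1 - X2) / (1 - (1 - X0 * X1) * X2) * ((1 - X0) * X2)) * (X0 / (1 - (1 - X0) * X2)) =
      (1 - X0) * (1 - X2) / (1 - (1 - X0 * X1) * X2) ∧
    1 - (1 - (1 - X0) * X2) * (X0 / (1 - (1 - X0) * X2)) = 1 - X0 ∧
    1 - (1 - X1) * (1 - X2) / (1 - (1 - X0 * X1) * X2) = X1 * (1 - (1 - X0) * X2) / (1 - (1 - X0 * X1) * X2) ∧
    1 - X0 / (1 - (1 - X0) * X2) = (1 - X0) * (1 - X2) / (1 - (1 - X0) * X2) := by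
  set L := 1 - (1 - X0 * X1) * X2 with hLdef
  set N := 1 - (1 - X0) * X2 with hNdef
  refine ⟨?_, ?_, ?_, ?_⟩
  · rw [eq_div_iff hL]; field_simp; rw [hLdef, hNdef]; ring
  · rw [mul_div_cancel₀ _ hN]
  · rw [eq_div_iff hL, sub_mul, div_mul_cancel₀ _ hL, hNdef, hLdef]; ring
  · rw [eq_div_iff hN, sub_mul, div_mul_cancel₀ _ hN, hNdef]; ring

/-- `ϑ` maps the open cube into itself. [RV (2.4)] -/
theorem rvTheta_mem_cube3 {x : Fin 3 → ℝ} (hx : x ∈ (univ.pi fun _ : Fin 3 => Ioo (0:ℝ) 1)) :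
    (![(1 - x 1) * x 2, (1 - x 0) * (1 - x 2) / (1 - (1 - x 0 * x 1) * x 2), x 1 / (1 - (1 - x 1) * x 2)] :
      Fin 3 → ℝ) ∈ (univ.pi fun _ : Fin 3 => Ioo (0:ℝ) 1) := by
  have h0 := mem_cube3 hx 0; have h1 := mem_cube3 hx 1; have h2 := mem_cube3 hx 2
  obtain ⟨hL, hN, hY, hZ, hX0, hX1⟩ := cube3_aux h0 h1 h2
  exact vec3_mem_cube3 ⟨hX0, hX1⟩
    ⟨div_pos (mul_pos (by linarith [h0.2]) (by linarith [h2.2])) hL, (div_lt_one hL).mpr hY⟩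
    ⟨div_pos h1.1 hN, (div_lt_one hN).mpr hZ⟩

/-- The inverse map maps the open cube into itself. [RV (2.6)] -/
theorem rvThetaInv_mem_cube3 {X : Fin 3 → ℝ} (hX : X ∈ (univ.pi fun _ : Fin 3 => Ioo (0:ℝ) 1)) :
    (![(1 - X 1) * (1 - X 2) / (1 - (1 - X 0 * X 1) * X 2), (1 - X 0) * X 2, X 0 / (1 - (1 - X 0) * X 2)] :
      Fin 3 → ℝ) ∈ (univ.pi fun _ : Fin 3 => Ioo (0:ℝ) 1) := by
  have h0 := mem_cube3 hX 0; have h1 := mem_cube3 hX 1; have h2 := mem_cube3 hX 2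
  obtain ⟨hL, hN, hY, hZ, hx0, hx1⟩ := cube3_aux h1 h0 h2
  have hL' : 0 < 1 - (1 - X 0 * X 1) * X 2 := by rw [mul_comm (X 0)]; exact hL
  have hY' : (1 - X 1) * (1 - X 2) < 1 - (1 - X 0 * X 1) * X 2 := by rw [mul_comm (X 0)]; exact hY
  exact vec3_mem_cube3
    ⟨div_pos (mul_pos (by linarith [h1.2]) (by linarith [h2.2])) hL', (div_lt_one hL').mpr hY'⟩
    ⟨hx0, hx1⟩ ⟨div_pos h0.1 hN, (div_lt_one hN).mpr hZ⟩

/-- `ϑ ∘ ϑ⁻¹ = id` on the cube. -/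
theorem rvTheta_rvThetaInv {X : Fin 3 → ℝ} (hX : X ∈ (univ.pi fun _ : Fin 3 => Ioo (0:ℝ) 1)) :
    (fun x : Fin 3 → ℝ => (![(1 - x 1) * x 2, (1 - x 0) * (1 - x 2) / (1 - (1 - x 0 * x 1) * x 2),
        x 1 / (1 - (1 - x 1) * x 2)] : Fin 3 → ℝ))
      ![(1 - X 1) * (1 - X 2) / (1 - (1 - X 0 * X 1) * X 2), (1 - X 0) * X 2, X 0 / (1 - (1 - X 0) * X 2)] = X := by
  have h0 := mem_cube3 hX 0; have h1 := mem_cube3 hX 1; have h2 := mem_cube3 hX 2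
  obtain ⟨hL, hN, -, -, -, -⟩ := cube3_aux h1 h0 h2
  have hL' : 1 - (1 - X 0 * X 1) * X 2 ≠ 0 := by rw [mul_comm (X 0)]; exact hL.ne'
  have hN' : 1 - (1 - X 0) * X 2 ≠ 0 := hN.ne'
  have hz : 1 - X 2 ≠ 0 := by linarith [h2.2]
  have hx1 : 1 - X 1 ≠ 0 := by linarith [h1.2]
  obtain ⟨eL, eN, e1m, e3m⟩ := rvThetaInv_atoms hL' hN'
  have h1mX0 : 1 - X 0 ≠ 0 := by linarith [h0.2]
  simp only [Matrix.cons_val_zero, Matrix.cons_val_one, Matrix.cons_val]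
  rw [eL, eN, e1m, e3m]
  have e0 : (1 - (1 - X 0) * X 2) * (X 0 / (1 - (1 - X 0) * X 2)) = X 0 := mul_div_cancel₀ _ hN'
  have e1 : X 1 * (1 - (1 - X 0) * X 2) / (1 - (1 - X 0 * X 1) * X 2) * ((1 - X 0) * (1 - X 2) / (1 - (1 - X 0) * X 2)) /
      ((1 - X 0) * (1 - X 2) / (1 - (1 - X 0 * X 1) * X 2)) = X 1 := by
    set L := 1 - (1 - X 0 * X 1) * X 2
    set N := 1 - (1 - X 0) * X 2
    field_simp
  have e2 : (1 - X 0) * X 2 / (1 - X 0) = X 2 := by field_simp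
  rw [e0, e1, e2]
  ext i; fin_cases i <;> simp

/-- `ϑ⁻¹ ∘ ϑ = id` on the cube. -/
theorem rvThetaInv_rvTheta {x : Fin 3 → ℝ} (hx : x ∈ (univ.pi fun _ : Fin 3 => Ioo (0:ℝ) 1)) :
    (fun X : Fin 3 → ℝ => (![(1 - X 1) * (1 - X 2) / (1 - (1 - X 0 * X 1) * X 2), (1 - X 0) * X 2,
        X 0 / (1 - (1 - X 0) * X 2)] : Fin 3 → ℝ))
      ![(1 - x 1) * x 2, (1 - x 0) * (1 - x 2) / (1 - (1 - x 0 * x 1) * x 2), x 1 / (1 - (1 - x 1) * x 2)] = x := by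
  have h0 := mem_cube3 hx 0; have h1 := mem_cube3 hx 1; have h2 := mem_cube3 hx 2
  obtain ⟨hL, hN, -, -, -, -⟩ := cube3_aux h0 h1 h2
  have hL' : 1 - (1 - x 0 * x 1) * x 2 ≠ 0 := hL.ne'
  have hN' : 1 - (1 - x 1) * x 2 ≠ 0 := hN.ne'
  have hz : 1 - x 2 ≠ 0 := by linarith [h2.2]
  have hx1 : 1 - x 1 ≠ 0 := by linarith [h1.2]
  obtain ⟨eY, eZ, eLn⟩ := rvTheta_atoms hL' hN'
  simp only [Matrix.cons_val_zero, Matrix.cons_val_one, Matrix.cons_val]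
  rw [eLn, eY, eZ]
  have e0 : x 0 * (1 - (1 - x 1) * x 2) / (1 - (1 - x 0 * x 1) * x 2) * ((1 - x 1) * (1 - x 2) / (1 - (1 - x 1) * x 2)) /
      ((1 - x 1) * (1 - x 2) / (1 - (1 - x 0 * x 1) * x 2)) = x 0 := by
    set L := 1 - (1 - x 0 * x 1) * x 2
    set N := 1 - (1 - x 1) * x 2
    field_simp
  have e1 : (1 - (1 - x 1) * x 2) * (x 1 / (1 - (1 - x 1) * x 2)) = x 1 := mul_div_cancel₀ _ hN'
  have e2 : (1 - x 1) * x 2 / (1 - x 1) = x 2 := by field_simp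
  rw [e0, e1, e2]
  ext i; fin_cases i <;> simp

/-- `ϑ` is injective on the cube. -/
theorem rvTheta_injOn :
    InjOn (fun x : Fin 3 → ℝ => (![(1 - x 1) * x 2, (1 - x 0) * (1 - x 2) / (1 - (1 - x 0 * x 1) * x 2),
      x 1 / (1 - (1 - x 1) * x 2)] : Fin 3 → ℝ)) (univ.pi fun _ : Fin 3 => Ioo (0:ℝ) 1) := by
  intro x hx x' hx' h
  rw [← rvThetaInv_rvTheta hx, ← rvThetaInv_rvTheta hx']
  exact congrArg (fun X : Fin 3 → ℝ => (![(1 - X 1) * (1 - X 2) / (1 - (1 - X 0 * X 1) * X 2), (1 - X 0) * X 2,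
    X 0 / (1 - (1 - X 0) * X 2)] : Fin 3 → ℝ)) h

/-- **`ϑ` maps `(0,1)³` ONTO itself.** [RV (2.4)] -/
theorem rvTheta_image :
    (fun x : Fin 3 → ℝ => (![(1 - x 1) * x 2, (1 - x 0) * (1 - x 2) / (1 - (1 - x 0 * x 1) * x 2),
      x 1 / (1 - (1 - x 1) * x 2)] : Fin 3 → ℝ)) '' (univ.pi fun _ : Fin 3 => Ioo (0:ℝ) 1) =
      (univ.pi fun _ : Fin 3 => Ioo (0:ℝ) 1) := by
  apply Subset.antisymm
  · rintro _ ⟨x, hx, rfl⟩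
    exact rvTheta_mem_cube3 hx
  · intro X hX
    exact ⟨_, rvThetaInv_mem_cube3 hX, rvTheta_rvThetaInv hX⟩

/-! ### The derivative of `ϑ` and its Jacobian determinant -/

/-- Derivative of `x ↦ (1 − x₁)x₂`. -/
theorem hasFDerivAt_X (x : Fin 3 → ℝ) :
    HasFDerivAt (fun x : Fin 3 → ℝ => (1 - x 1) * x 2)
      ((-(x 2)) • (proj 1 : (Fin 3 → ℝ) →L[ℝ] ℝ) + (1 - x 1) • (proj 2 : (Fin 3 → ℝ) →L[ℝ] ℝ)) x := by
  have h := ((hasFDerivAt_apply (𝕜 := ℝ) 1 x).const_sub 1).mul (hasFDerivAt_apply (𝕜 := ℝ) 2 x)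
  refine HasFDerivAt.congr_fderiv h ?_
  ext v; simp; ring

/-- Derivative of `x ↦ L(x) = 1 − (1 − x₀x₁)x₂`. -/
theorem hasFDerivAt_L (x : Fin 3 → ℝ) :
    HasFDerivAt (fun x : Fin 3 → ℝ => 1 - (1 - x 0 * x 1) * x 2)
      ((x 1 * x 2) • (proj 0 : (Fin 3 → ℝ) →L[ℝ] ℝ) + (x 0 * x 2) • (proj 1 : (Fin 3 → ℝ) →L[ℝ] ℝ)
        + (-(1 - x 0 * x 1)) • (proj 2 : (Fin 3 → ℝ) →L[ℝ] ℝ)) x := by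
  have h := ((((hasFDerivAt_apply (𝕜 := ℝ) 0 x).mul (hasFDerivAt_apply (𝕜 := ℝ) 1 x)).const_sub 1).mul
    (hasFDerivAt_apply (𝕜 := ℝ) 2 x)).const_sub 1
  refine HasFDerivAt.congr_fderiv h ?_
  ext v; simp; ring

/-- Derivative of `x ↦ N(x) = 1 − (1 − x₁)x₂`. -/
theorem hasFDerivAt_N (x : Fin 3 → ℝ) :
    HasFDerivAt (fun x : Fin 3 → ℝ => 1 - (1 - x 1) * x 2)
      ((x 2) • (proj 1 : (Fin 3 → ℝ) →L[ℝ] ℝ) + (-(1 - x 1)) • (proj 2 : (Fin 3 → ℝ) →L[ℝ] ℝ)) x := by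
  have h := (((hasFDerivAt_apply (𝕜 := ℝ) 1 x).const_sub 1).mul (hasFDerivAt_apply (𝕜 := ℝ) 2 x)).const_sub 1
  refine HasFDerivAt.congr_fderiv h ?_
  ext v; simp; ring

/-- Derivative of `x ↦ Y(x) = (1−x₀)(1−x₂)/L(x)` where `L ≠ 0`. -/
theorem hasFDerivAt_Y (x : Fin 3 → ℝ) (hL : 1 - (1 - x 0 * x 1) * x 2 ≠ 0) :
    HasFDerivAt (fun x : Fin 3 → ℝ => (1 - x 0) * (1 - x 2) / (1 - (1 - x 0 * x 1) * x 2))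
      ((-((1 - x 2) * (1 - (1 - x 1) * x 2)) / (1 - (1 - x 0 * x 1) * x 2) ^ 2) • (proj 0 : (Fin 3 → ℝ) →L[ℝ] ℝ)
        + (-(x 0 * x 2 * (1 - x 0) * (1 - x 2)) / (1 - (1 - x 0 * x 1) * x 2) ^ 2) • (proj 1 : (Fin 3 → ℝ) →L[ℝ] ℝ)
        + (-(x 0 * x 1 * (1 - x 0)) / (1 - (1 - x 0 * x 1) * x 2) ^ 2) • (proj 2 : (Fin 3 → ℝ) →L[ℝ] ℝ)) x := by
  have hnum : HasFDerivAt (fun x : Fin 3 → ℝ => (1 - x 0) * (1 - x 2))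
      ((-(1 - x 2)) • (proj 0 : (Fin 3 → ℝ) →L[ℝ] ℝ) + (-(1 - x 0)) • (proj 2 : (Fin 3 → ℝ) →L[ℝ] ℝ)) x := by
    have h := ((hasFDerivAt_apply (𝕜 := ℝ) 0 x).const_sub 1).mul ((hasFDerivAt_apply (𝕜 := ℝ) 2 x).const_sub 1)
    refine HasFDerivAt.congr_fderiv h ?_
    ext v; simp; ring
  have hmul := hnum.mul ((hasFDerivAt_inv hL).comp x (hasFDerivAt_L x))
  refine HasFDerivAt.congr_fderiv (hmul.congr_of_eventuallyEq ?_) ?_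
  · exact Filter.Eventually.of_forall fun w => by simp [div_eq_mul_inv]
  · ext v
    simp
    set L := 1 - (1 - x 0 * x 1) * x 2 with hLdef
    field_simp
    simp only [hLdef]
    ring

/-- Derivative of `x ↦ Z(x) = x₁/N(x)` where `N ≠ 0`. -/
theorem hasFDerivAt_Z (x : Fin 3 → ℝ) (hN : 1 - (1 - x 1) * x 2 ≠ 0) :
    HasFDerivAt (fun x : Fin 3 → ℝ => x 1 / (1 - (1 - x 1) * x 2))
      (((1 - x 2) / (1 - (1 - x 1) * x 2) ^ 2) • (proj 1 : (Fin 3 → ℝ) →L[ℝ] ℝ)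
        + ((x 1 * (1 - x 1)) / (1 - (1 - x 1) * x 2) ^ 2) • (proj 2 : (Fin 3 → ℝ) →L[ℝ] ℝ)) x := by
  have hmul := (hasFDerivAt_apply (𝕜 := ℝ) 1 x).mul ((hasFDerivAt_inv hN).comp x (hasFDerivAt_N x))
  refine HasFDerivAt.congr_fderiv (hmul.congr_of_eventuallyEq ?_) ?_
  · exact Filter.Eventually.of_forall fun w => by simp [div_eq_mul_inv]
  · ext v
    simp
    set N := 1 - (1 - x 1) * x 2 with hNdef
    field_simp
    simp only [hNdef]
    ring

/-- **`ϑ` is differentiable where `L, N ≠ 0`, with Jacobian determinant `det Dϑ(x) = −(1−x₁)(1−x₂)/L(x)²**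
(so `|det| = (1−(1−XY)Z)/(1−(1−xy)z)`, RV (2.5)). -/
theorem hasFDerivAt_rvTheta (x : Fin 3 → ℝ) (hL : 1 - (1 - x 0 * x 1) * x 2 ≠ 0) (hN : 1 - (1 - x 1) * x 2 ≠ 0) :
    ∃ f' : (Fin 3 → ℝ) →L[ℝ] (Fin 3 → ℝ),
      HasFDerivAt (fun x : Fin 3 → ℝ => (![(1 - x 1) * x 2, (1 - x 0) * (1 - x 2) / (1 - (1 - x 0 * x 1) * x 2),
        x 1 / (1 - (1 - x 1) * x 2)] : Fin 3 → ℝ)) f' x ∧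
      f'.det = -((1 - x 1) * (1 - x 2)) / (1 - (1 - x 0 * x 1) * x 2) ^ 2 := by
  refine ⟨ContinuousLinearMap.pi
    ![(-(x 2)) • (proj 1 : (Fin 3 → ℝ) →L[ℝ] ℝ) + (1 - x 1) • (proj 2 : (Fin 3 → ℝ) →L[ℝ] ℝ),
      (-((1 - x 2) * (1 - (1 - x 1) * x 2)) / (1 - (1 - x 0 * x 1) * x 2) ^ 2) • (proj 0 : (Fin 3 → ℝ) →L[ℝ] ℝ)
        + (-(x 0 * x 2 * (1 - x 0) * (1 - x 2)) / (1 - (1 - x 0 * x 1) * x 2) ^ 2) • (proj 1 : (Fin 3 → ℝ) →L[ℝ] ℝ)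
        + (-(x 0 * x 1 * (1 - x 0)) / (1 - (1 - x 0 * x 1) * x 2) ^ 2) • (proj 2 : (Fin 3 → ℝ) →L[ℝ] ℝ),
      ((1 - x 2) / (1 - (1 - x 1) * x 2) ^ 2) • (proj 1 : (Fin 3 → ℝ) →L[ℝ] ℝ)
        + ((x 1 * (1 - x 1)) / (1 - (1 - x 1) * x 2) ^ 2) • (proj 2 : (Fin 3 → ℝ) →L[ℝ] ℝ)], ?_, ?_⟩
  · refine hasFDerivAt_pi'' fun k => ?_
    rw [ContinuousLinearMap.proj_pi]
    fin_cases k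
    · simpa using hasFDerivAt_X x
    · simpa using hasFDerivAt_Y x hL
    · simpa using hasFDerivAt_Z x hN
  · have hM : LinearMap.toMatrix' ((ContinuousLinearMap.pi
        ![(-(x 2)) • (proj 1 : (Fin 3 → ℝ) →L[ℝ] ℝ) + (1 - x 1) • (proj 2 : (Fin 3 → ℝ) →L[ℝ] ℝ),
          (-((1 - x 2) * (1 - (1 - x 1) * x 2)) / (1 - (1 - x 0 * x 1) * x 2) ^ 2) • (proj 0 : (Fin 3 → ℝ) →L[ℝ] ℝ)
            + (-(x 0 * x 2 * (1 - x 0) * (1 - x 2)) / (1 - (1 - x 0 * x 1) * x 2) ^ 2) •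
              (proj 1 : (Fin 3 → ℝ) →L[ℝ] ℝ)
            + (-(x 0 * x 1 * (1 - x 0)) / (1 - (1 - x 0 * x 1) * x 2) ^ 2) • (proj 2 : (Fin 3 → ℝ) →L[ℝ] ℝ),
          ((1 - x 2) / (1 - (1 - x 1) * x 2) ^ 2) • (proj 1 : (Fin 3 → ℝ) →L[ℝ] ℝ)
            + ((x 1 * (1 - x 1)) / (1 - (1 - x 1) * x 2) ^ 2) • (proj 2 : (Fin 3 → ℝ) →L[ℝ] ℝ)] :
            (Fin 3 → ℝ) →L[ℝ] (Fin 3 → ℝ)) : (Fin 3 → ℝ) →ₗ[ℝ] (Fin 3 → ℝ))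
        = !![0, -(x 2), 1 - x 1;
             -((1 - x 2) * (1 - (1 - x 1) * x 2)) / (1 - (1 - x 0 * x 1) * x 2) ^ 2,
               -(x 0 * x 2 * (1 - x 0) * (1 - x 2)) / (1 - (1 - x 0 * x 1) * x 2) ^ 2,
               -(x 0 * x 1 * (1 - x 0)) / (1 - (1 - x 0 * x 1) * x 2) ^ 2;
             0, (1 - x 2) / (1 - (1 - x 1) * x 2) ^ 2, (x 1 * (1 - x 1)) / (1 - (1 - x 1) * x 2) ^ 2] := by
      ext i j
      rw [LinearMap.toMatrix'_apply]
      fin_cases i <;> fin_cases j <;> simp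
    rw [ContinuousLinearMap.det, ← LinearMap.det_toMatrix', hM, Matrix.det_fin_three]
    simp only [Matrix.of_apply, Matrix.cons_val', Matrix.cons_val_zero, Matrix.cons_val_one, Matrix.cons_val,
      Matrix.empty_val', Matrix.cons_val_fin_one]
    set L := 1 - (1 - x 0 * x 1) * x 2 with hLdef
    set N := 1 - (1 - x 1) * x 2 with hNdef
    field_simp
    simp only [hNdef]
    ring

/-! ### The change of variables -/

/-- The open cube `(0,1)³` is measurable. -/
theorem measurableSet_cube3 : MeasurableSet (univ.pi fun _ : Fin 3 => Ioo (0:ℝ) 1) :=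
  MeasurableSet.univ_pi fun _ => measurableSet_Ioo

/-- **Change of variables by `ϑ`**: for every `g`,
`∫_{(0,1)³} g = ∫_{(0,1)³} (1−x₁)(1−x₂)/L(x)² · g(ϑ x) dx` (Bochner integrals; both sides junk `0` together).
[RV (2.5)–(2.6)] -/
theorem integral_comp_rvTheta (g : (Fin 3 → ℝ) → ℝ) :
    ∫ X in (univ.pi fun _ : Fin 3 => Ioo (0:ℝ) 1), g X =
      ∫ x in (univ.pi fun _ : Fin 3 => Ioo (0:ℝ) 1), (1 - x 1) * (1 - x 2) / (1 - (1 - x 0 * x 1) * x 2) ^ 2 *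
        g ![(1 - x 1) * x 2, (1 - x 0) * (1 - x 2) / (1 - (1 - x 0 * x 1) * x 2), x 1 / (1 - (1 - x 1) * x 2)] := by
  have hex : ∀ x : Fin 3 → ℝ, ∃ f' : (Fin 3 → ℝ) →L[ℝ] (Fin 3 → ℝ), x ∈ (univ.pi fun _ : Fin 3 => Ioo (0:ℝ) 1) →
      HasFDerivAt (fun x : Fin 3 → ℝ => (![(1 - x 1) * x 2, (1 - x 0) * (1 - x 2) / (1 - (1 - x 0 * x 1) * x 2),
        x 1 / (1 - (1 - x 1) * x 2)] : Fin 3 → ℝ)) f' x ∧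
      f'.det = -((1 - x 1) * (1 - x 2)) / (1 - (1 - x 0 * x 1) * x 2) ^ 2 := by
    intro x
    by_cases hx : x ∈ (univ.pi fun _ : Fin 3 => Ioo (0:ℝ) 1)
    · obtain ⟨hL, hN, -⟩ := cube3_aux (mem_cube3 hx 0) (mem_cube3 hx 1) (mem_cube3 hx 2)
      obtain ⟨f', hf'⟩ := hasFDerivAt_rvTheta x hL.ne' hN.ne'
      exact ⟨f', fun _ => hf'⟩
    · exact ⟨0, fun h => (hx h).elim⟩
  choose f' hf' using hex
  have hderiv : ∀ x ∈ (univ.pi fun _ : Fin 3 => Ioo (0:ℝ) 1), HasFDerivWithinAt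
      (fun x : Fin 3 → ℝ => (![(1 - x 1) * x 2, (1 - x 0) * (1 - x 2) / (1 - (1 - x 0 * x 1) * x 2),
        x 1 / (1 - (1 - x 1) * x 2)] : Fin 3 → ℝ)) (f' x) (univ.pi fun _ : Fin 3 => Ioo (0:ℝ) 1) x :=
    fun x hx => (hf' x hx).1.hasFDerivWithinAt
  have hcv := integral_image_eq_integral_abs_det_fderiv_smul volume measurableSet_cube3 hderiv rvTheta_injOn g
  rw [rvTheta_image] at hcv
  rw [hcv]
  refine setIntegral_congr_fun measurableSet_cube3 fun x hx => ?_
  have h1 := mem_cube3 hx 1; have h2 := mem_cube3 hx 2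
  obtain ⟨hL, -⟩ := cube3_aux (mem_cube3 hx 0) h1 h2
  rw [(hf' x hx).2, smul_eq_mul, neg_div, abs_neg,
    abs_of_pos (div_pos (mul_pos (by linarith [h1.2]) (by linarith [h2.2])) (pow_pos hL 2))]

/-! ### RV's `ϑ`-invariance of the Beukers-type triple integrals (integer exponents) -/

/-- **Pointwise**: the integrand `x^h(1−x)^l y^k(1−y)^s z^j(1−z)^q L^{−c}` at `ϑ(x,y,z)`, times the Jacobian
`(1−y)(1−z)/L²`, is `x^s(1−x)^k y^j(1−y)^{h+q+1−c} z^h(1−z)^{k+q+1−c} L^{−(k+s+2−c)}` on the open cube, provided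
`j + q = l + s` [RV (2.3)] (the exponent of the extra atom `N = 1−(1−y)z` is `l+s−j−q`). A Laurent-monomial identity
in the eight positive atoms; compare logarithms. -/
theorem rv_integrand_theta (h l k s j q c : ℤ) (hjq : j + q = l + s) {x0 x1 x2 : ℝ} (h0 : 0 < x0 ∧ x0 < 1)
    (h1 : 0 < x1 ∧ x1 < 1) (h2 : 0 < x2 ∧ x2 < 1) :
    (1 - x1) * (1 - x2) / (1 - (1 - x0 * x1) * x2) ^ 2 *
        (((1 - x1) * x2) ^ h * (1 - (1 - x1) * x2) ^ l * ((1 - x0) * (1 - x2) / (1 - (1 - x0 * x1) * x2)) ^ k *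
          (1 - (1 - x0) * (1 - x2) / (1 - (1 - x0 * x1) * x2)) ^ s * (x1 / (1 - (1 - x1) * x2)) ^ j *
          (1 - x1 / (1 - (1 - x1) * x2)) ^ q /
          (1 - (1 - (1 - x1) * x2 * ((1 - x0) * (1 - x2) / (1 - (1 - x0 * x1) * x2))) * (x1 / (1 - (1 - x1) * x2))) ^ c) =
      x0 ^ s * (1 - x0) ^ k * x1 ^ j * (1 - x1) ^ (h + q + 1 - c) * x2 ^ h * (1 - x2) ^ (k + q + 1 - c) /
        (1 - (1 - x0 * x1) * x2) ^ (k + s + 2 - c) := by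
  obtain ⟨hL, hN, -⟩ := cube3_aux h0 h1 h2
  obtain ⟨eY, eZ, eLn⟩ := rvTheta_atoms hL.ne' hN.ne'
  rw [eY, eZ, eLn]
  have u0 : 0 < 1 - x0 := by linarith [h0.2]
  have u1 : 0 < 1 - x1 := by linarith [h1.2]
  have u2 : 0 < 1 - x2 := by linarith [h2.2]
  have hjq' : (j : ℝ) + q = l + s := by exact_mod_cast hjq
  have a0 := h0.1; have a1 := h1.1; have a2 := h2.1
  set v0 := 1 - x0 with hv0
  set v1 := 1 - x1 with hv1
  set v2 := 1 - x2 with hv2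
  set L := 1 - (1 - x0 * x1) * x2 with hLd
  set N := 1 - (1 - x1) * x2 with hNd
  clear_value v0 v1 v2 L N
  refine (Real.log_injOn_pos.eq_iff ?_ ?_).1 ?_
  · rw [Set.mem_Ioi]; positivity
  · rw [Set.mem_Ioi]; positivity
  simp (disch := positivity) only [Real.log_mul, Real.log_div, Real.log_zpow, Real.log_pow]
  push_cast
  linear_combination (-Real.log N) * hjq'

/-- **Rhin–Viola's `ϑ`-invariance** [RV (2.4)–(2.6): "`I(h,j,k,l,m,q,r,s) = I(j,k,l,m,q,r,s,h)`" for the generator `ϑ`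
of their dihedral group `Θ`], for ALL integer exponents with `j + q = l + s` (RV (2.3)); in RV's letters `c = q+h−r+1`:
`∫ x^h(1−x)^l y^k(1−y)^s z^j(1−z)^q L^{−c} = ∫ x^s(1−x)^k y^j(1−y)^{h+q+1−c} z^h(1−z)^{k+q+1−c} L^{−(k+s+2−c)}`
over `(0,1)³`, `L = 1−(1−xy)z` (no convergence hypothesis: both sides junk `0` together). -/
theorem rv_theta_invariance (h l k s j q c : ℤ) (hjq : j + q = l + s) :
    ∫ x in (univ.pi fun _ : Fin 3 => Ioo (0:ℝ) 1),
        x 0 ^ h * (1 - x 0) ^ l * x 1 ^ k * (1 - x 1) ^ s * x 2 ^ j * (1 - x 2) ^ q / (1 - (1 - x 0 * x 1) * x 2) ^ c =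
      ∫ x in (univ.pi fun _ : Fin 3 => Ioo (0:ℝ) 1),
        x 0 ^ s * (1 - x 0) ^ k * x 1 ^ j * (1 - x 1) ^ (h + q + 1 - c) * x 2 ^ h * (1 - x 2) ^ (k + q + 1 - c) /
          (1 - (1 - x 0 * x 1) * x 2) ^ (k + s + 2 - c) := by
  rw [integral_comp_rvTheta]
  refine setIntegral_congr_fun measurableSet_cube3 fun x hx => ?_
  simp only [Matrix.cons_val_zero, Matrix.cons_val_one, Matrix.cons_val]
  exact rv_integrand_theta h l k s j q c hjq (mem_cube3 hx 0) (mem_cube3 hx 1) (mem_cube3 hx 2)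

end Summit.KontsevichZagierPeriods.Zeta5Search.RhinViolaTheta

end
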